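import Summits.NavierStokesRegularity.NavierStokesRegularity.Theorems.QuietScarPocketDoorLZoomLimit
import Summits.NavierStokesRegularity.NavierStokesRegularity.Theorems.QuietScarPocketDoorLZoomTop
import HarnessLib

/-!
# QuietScarPocketDoorLZoom — door S31 «QuietScarPocketDoor», §B «L-POCKET SCHEMA» (texts nsreg-p1 g25 `r29/Sketch31D.lean`
# 8bb56c0a84466268, tree `…QuietScarPocketDoorLPocketDefs`): PLATE (P1) PK1-L `lPocketZoom_holds : ∀ F L, LPocketZoom L`

K1_L, the class zoom at the pocket scale for an ARBITRARY continuous linear constraint `L` on velocity gradients, assembled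
exactly as PK1's F5 (`scarPocketZoom_holds`, `…QuietScarPocketDoorZoom`): F3_L `exists_lPocket_classZoom` (`…LZoomLimit`),
F3b `ae_apex_of_classZoom` (ns-sz-p1, `…ZoomApexAE`), F4_L `exists_topGrad_of_classZoom` (`…LZoomTop`: `TopGradTendsto`, decay,
scale-invariant gradient decay, incompressibility, `L`-annihilation on the pocket), F4b `offApexClassical_of_typeIAncientMild`
(nsreg-C26-p1, `…ZoomOffApex`); representative `Uc := U`, the smooth Type-I ancient mild limit itself.

* `lPocketZoom_holds_of_constraint L : LPocketZoom L` — universe-polymorphic in the target `F` of `L`;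
* `lPocketZoom_holds : ∀ F L, LPocketZoom L` — the plate in the shape consumed by `lPocketSchema_of` and the instance closers
  (`targetStrainPocket_of`, `targetPlanarPocket_of`, `targetCombedPocket_of`).

Width-seat file (prover ns-imp-p1 g4, first plate hand of the S-door lane, DIRECTOR-NS #209 (2) / #210 (3); planner of record
nsreg-p1 g25), `--supports stmt-NavierStokesRegularity-0056 --as helper`.  HONEST FRAMING: §B is a corollary SCHEMA of the S31
regularity CRITERION about HYPOTHETICAL one-point Type-I blow-up profiles; the remaining plates (PLℓ `TerminalTraceAnalyticVelocity`,
PT-L `FrameTransferL`, the static rigidities) are NOT proved here; item 0056 `NoTypeII` and NS regularity are NOT proved.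
-/

noncomputable section

set_option linter.dupNamespace false

namespace Summit.NavierStokesRegularity.NavierStokesRegularity.Theorems.QuietScarPocketDoor

open MeasureTheory Set Function Filter Topology TopologicalSpace Metric
open scoped NNReal ENNReal Topology
open Literature.Analysis Literature.Analysis.FluidPDE

/-- **PLATE (P1) PK1-L, universe-polymorphic form: `LPocketZoom L` for every continuous linear constraint `L`**
(representative `Uc := U`, the smooth mild limit itself). -/
theorem lPocketZoom_holds_of_constraint {F : Type*} [NormedAddCommGroup F] [NormedSpace ℝ F]
    (L : (EuclideanSpace ℝ (Fin 3) →L[ℝ] EuclideanSpace ℝ (Fin 3)) →L[ℝ] F) : LPocketZoom L := by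
  intro Cu hCu κ hκ hκ1 hdoor
  obtain ⟨w, π, Rk, ek, εk, I, e, U, P, H, -, hRk, hcl, hone, hIk, hek1, hek, he, -, hε, hpocket,
    hU, hsw, hwg, hIU, hsing, hL3⟩ := exists_lPocket_classZoom L hdoor
  have hUc : ContinuousOn (uncurry U) (Iio (0 : ℝ) ×ˢ univ) := hU.1.continuousOn
  have hapex := ae_apex_of_classZoom hRk hone hUc hL3
  obtain ⟨V₀, htop, hdec, hgdec, hdiv, hpk⟩ :=
    exists_topGrad_of_classZoom L hCu hκ1 hRk hcl hone hIk hek1 hek hε hpocket hU hL3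
  have hoff := offApexClassical_of_typeIAncientMild hCu hU hapex
  have _hκ := hκ
  refine ⟨U, P, H, Cu, e, U, V₀, hsw, hwg, hIU, hapex, he, hsing, Filter.EventuallyEq.rfl, ?_, hoff, htop, hdec, hgdec,
    hdiv, hpk⟩
  exact hUc.mono (prod_mono Ioo_subset_Iio_self (subset_univ _))

/-- **PLATE (P1) PK1-L `lPocketZoom_holds : ∀ F L, LPocketZoom L`** — the generic K1_L zoom for every constraint, in the shape
consumed by `lPocketSchema_of` / `targetStrainPocket_of` / `targetPlanarPocket_of` / `targetCombedPocket_of`. -/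
theorem lPocketZoom_holds : ∀ (F : Type) [NormedAddCommGroup F] [NormedSpace ℝ F]
    (L : (EuclideanSpace ℝ (Fin 3) →L[ℝ] EuclideanSpace ℝ (Fin 3)) →L[ℝ] F), LPocketZoom L :=
  fun _ _ _ L => lPocketZoom_holds_of_constraint L

/-- **The schema modulo LEG F (velocity form)**: `TerminalTraceAnalyticVelocity → LPocketSchema` (plate P1 discharged;
`lPocketSchema_of` by name). -/
theorem lPocketSchema_of_terminalTraceAnalyticVelocity (hF : TerminalTraceAnalyticVelocity) : LPocketSchema :=
  lPocketSchema_of lPocketZoom_holds hF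

end Summit.NavierStokesRegularity.NavierStokesRegularity.Theorems.QuietScarPocketDoor

end
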